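import Literature.AlgebraicGeometry.Morphisms.CechModuleSheafHom
import Literature.AlgebraicGeometry.Morphisms.CechModuleExactH0
import Literature.AlgebraicGeometry.Morphisms.CechModuleUnit
import Literature.AlgebraicGeometry.Modules.SerreTwistHom
import HarnessLib

/-!
# The connecting homomorphism of `𝓗om(E, P′) → 𝓗om(E, P) → 𝓗om(E, N)` vanishes on a morphism
# `t : E → N` iff `t` factors through `q : P → N`

Sequel of `Morphisms/CechModuleExactH0` (exactness of the low-degree Čech sequence at `Ȟ⁰(M″)`) and
`Morphisms/CechModuleSheafHom` (the Čech exactness data of `𝓗om(E, –)` applied to a short exact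
sequence). For a scheme `f : X → Spec A`, a COVERING `𝒰` of `X`, morphisms of `𝒪_X`-modules
`j : P′ → P`, `q : P → N`, an `𝒪_X`-module `E` and sectionwise exactness data `h` of
`𝓗om(E, P′) —𝓗om(E,j)→ 𝓗om(E, P) —𝓗om(E,q)→ 𝓗om(E, N)` on `𝒰`:

* `cechMapH0_cechMH0EquivSections` — naturality of `Γ(X, M) ≅ Ȟ⁰(𝒰, M)` (`Morphisms/CechModuleUnit`);
* `homSectionTop`-free bookkeeping: a morphism `t : E → N` IS a global section of `𝓗om(E, N)`
  (`Modules/SheafHomFunctor.sheafHomSectionsEquiv`, definitional), and `homOfOverTop`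
  (`Modules/SerreTwistHom`) recovers a morphism from its global section
  (`homOfOverTop_overFunctor_map`, `overFunctor_map_homOfOverTop`);
* **`CechExactData.cechDelta_hom_eq_zero_iff_exists_fac`** — `δ([t]) = 0` in `Ȟ¹(𝒰, 𝓗om(E, P′))` iff
  `t = g ≫ q` for some `g : E → P`: exactness at `Ȟ⁰(𝓗om(E, N))` (`ker δ = im Ȟ⁰(𝓗om(E, q))`,
  Hartshorne III Thm. 4.5 proof) plus `Ȟ⁰ = Γ(X, –)` and `Γ(X, 𝓗om(E, M)) = Hom(E, M)`.

This is the Čech half of «`ker δ = P(M, M)`» for full sheaves (Artin–Verdier 1985, proof of (1.11);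
cell res-hironaka, chain W4.4, crux `NoZenoR` stmt-ResolutionOfSingularities-19943, G2 item A5), stated
for arbitrary schemes and modules. Everything is proved; no named facts.

## References

* R. Hartshorne, *Algebraic Geometry*, GTM 52 (1977): III, proof of Thm. 4.5 (p. 222); II Ex. 1.15.
  [Hartshorne1977]
* The Stacks Project, Tag 01ED (Cohomology, Section 20.9). [StacksProject]
-/

noncomputable section

open CategoryTheory AlgebraicGeometry Limits TopologicalSpace Opposite
open Literature.AlgebraicGeometry.Modules Literature.AlgebraicGeometry.Modules.SerreTwist

universe u v

namespace Literature.AlgebraicGeometry.Morphisms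

variable {A : Type u} [CommRing A] {X : Scheme.{u}} (f : X ⟶ Spec (.of A)) {ι : Type v}
  (U : ι → X.Opens)

/-! ## Naturality of `Γ(X, M) ≅ Ȟ⁰(𝒰, M)` -/

/-- The components of the Čech `0`-cocycle attached to a global section are its restrictions.
[cite: GortzWedhorn2023, Lemma 21.65 (p. 259)] -/
theorem cechMH0EquivSections_coe_apply {M : X.Modules} (hU : ⨆ i, U i = ⊤) (s : MSections f M ⊤)
    (i : ι) : (cechMH0EquivSections f U M hU s : CechMC0 f M U) i = MSections.res f M le_top s := rfl

/-- **Naturality of `Γ(X, –) ≅ Ȟ⁰(𝒰, –)`**: `Ȟ⁰(φ)` of the cocycle of a global section `s` is the cocycle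
of `φ(s)`. [cite: GortzWedhorn2023, Lemma 21.65 (p. 259)] -/
theorem cechMapH0_cechMH0EquivSections {M N : X.Modules} (φ : M ⟶ N) (hU : ⨆ i, U i = ⊤)
    (s : MSections f M ⊤) :
    cechMapH0 f φ U (cechMH0EquivSections f U M hU s) =
      cechMH0EquivSections f U N hU (MSections.app f φ ⊤ s) := by
  apply Subtype.ext
  funext i
  rw [cechMapH0_coe, cechMapC0_apply, cechMH0EquivSections_coe_apply,
    cechMH0EquivSections_coe_apply, MSections.res_app]

/-! ## Morphisms and their global sections in `𝓗om` -/

section OverTop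

variable {E N : X.Modules}

/-- A morphism is recovered from its restriction to the whole space: `homOfOverTop (t|_⊤) = t`.
[cite: Hartshorne1977, II Ex. 1.15] -/
theorem homOfOverTop_overFunctor_map (t : E ⟶ N) :
    homOfOverTop ((SheafOfModules.overFunctor _ ⊤).map t) = t := by
  refine Scheme.Modules.hom_ext _ _ fun W => ?_
  ext s
  rw [homOfOverTop_app, ← Category.comp_id ((SheafOfModules.overFunctor _ ⊤).map t),
    appLE_over_map_comp, appLE_id]

/-- Conversely `(homOfOverTop ψ)|_⊤ = ψ`. [cite: Hartshorne1977, II Ex. 1.15] -/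
theorem overFunctor_map_homOfOverTop (ψ : E.over ⊤ ⟶ N.over ⊤) :
    (SheafOfModules.overFunctor _ ⊤).map (homOfOverTop ψ) = ψ := by
  refine hom_ext_of_appLE fun W k s => ?_
  rw [← Category.comp_id ((SheafOfModules.overFunctor _ ⊤).map (homOfOverTop ψ)),
    appLE_over_map_comp, appLE_id, homOfOverTop_app]
  exact appLE_congr_hom _ _ _ _

end OverTop

/-! ## `δ([t]) = 0 ↔ t` factors through `q` -/

namespace CechExactData

variable {f U} {E P' P N : X.Modules} {j : P' ⟶ P} {q : P ⟶ N}

/-- **`δ([t]) = 0` iff `t` factors through `q`.** For sectionwise exactness data of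
`𝓗om(E, P′) → 𝓗om(E, P) → 𝓗om(E, N)` on a covering `𝒰` and a morphism `t : E → N`, viewed as the
global section `t|_⊤ ∈ Γ(X, 𝓗om(E, N)) = Ȟ⁰(𝒰, 𝓗om(E, N))`: its image under the connecting
homomorphism `δ : Ȟ⁰(𝒰, 𝓗om(E, N)) → Ȟ¹(𝒰, 𝓗om(E, P′))` vanishes iff `t = g ≫ q` for some
`g : E → P` (`ker δ = im Ȟ⁰(𝓗om(E, q))`, and a global section of `𝓗om(E, P)` is a morphism).
[cite: Hartshorne1977, III Thm. 4.5 proof p. 222 (long exact sequence of Čech cohomology)] -/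
theorem cechDelta_hom_eq_zero_iff_exists_fac
    (h : CechExactData f U (sheafHomMap E j) (sheafHomMap E q)) (hU : ⨆ i, U i = ⊤) (t : E ⟶ N) :
    h.cechDelta (cechMH0EquivSections f U (sheafHom E N) hU
        ((sheafHomSectionsEquiv E N ⊤).symm ((SheafOfModules.overFunctor _ ⊤).map t))) = 0 ↔
      ∃ g : E ⟶ P, g ≫ q = t := by
  constructor
  · intro hδ
    obtain ⟨b, hb⟩ := h.exists_cechMapH0_eq_of_cechDelta_eq_zero _ hδ
    -- the global section of `𝓗om(E, P)` behind `b` is a morphism `E|_⊤ → P|_⊤`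
    set ψ : MSections f (sheafHom E P) ⊤ := (cechMH0EquivSections f U (sheafHom E P) hU).symm b
      with hψ
    have hbψ : b = cechMH0EquivSections f U (sheafHom E P) hU ψ := by
      rw [hψ, LinearEquiv.apply_symm_apply]
    refine ⟨homOfOverTop (sheafHomSectionsEquiv E P ⊤ ψ), ?_⟩
    -- `ψ ≫ q|_⊤ = t|_⊤` from `Ȟ⁰(𝓗om(E, q)) b = [t]`
    have hq : MSections.app f (sheafHomMap E q) ⊤ ψ =
        (sheafHomSectionsEquiv E N ⊤).symm ((SheafOfModules.overFunctor _ ⊤).map t) := by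
      apply (cechMH0EquivSections f U (sheafHom E N) hU).injective
      rw [← cechMapH0_cechMH0EquivSections, ← hbψ, hb]
    have hq' : (sheafHomSectionsEquiv E P ⊤ ψ) ≫ (SheafOfModules.overFunctor _ ⊤).map q =
        (SheafOfModules.overFunctor _ ⊤).map t := hq
    rw [← homOfOverTop_overFunctor_map t, ← hq']
    refine Scheme.Modules.hom_ext _ _ fun W => ?_
    ext s
    change q.app W (appLE (sheafHomSectionsEquiv E P ⊤ ψ) (homOfLE le_top) s) =
      appLE ((sheafHomSectionsEquiv E P ⊤ ψ) ≫ (SheafOfModules.overFunctor _ ⊤).map q)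
        (homOfLE le_top) s
    rw [appLE_comp_over_map]
  · rintro ⟨g, rfl⟩
    have hsec : (sheafHomSectionsEquiv E N ⊤).symm ((SheafOfModules.overFunctor _ ⊤).map (g ≫ q)) =
        MSections.app f (sheafHomMap E q) ⊤
          ((sheafHomSectionsEquiv E P ⊤).symm ((SheafOfModules.overFunctor _ ⊤).map g)) := by
      change (SheafOfModules.overFunctor _ ⊤).map (g ≫ q) =
        (SheafOfModules.overFunctor _ ⊤).map g ≫ (SheafOfModules.overFunctor _ ⊤).map q
      rw [Functor.map_comp]
    have key := h.cechDelta_cechMapH0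
      (cechMH0EquivSections f U (sheafHom E P) hU
        ((sheafHomSectionsEquiv E P ⊤).symm ((SheafOfModules.overFunctor _ ⊤).map g)))
    rw [cechMapH0_cechMH0EquivSections, ← hsec] at key
    exact key

end CechExactData

end Literature.AlgebraicGeometry.Morphisms

end
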